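import Summits.BirchSwinnertonDyer.Rank1Residual.Additive.QuadraticBranchEvenControlZero
import Summits.BirchSwinnertonDyer.Rank1Residual.Additive.QuadraticBranchEvenExactControl
import Summits.BirchSwinnertonDyer.Rank1Residual.Additive.QuadraticBranchEvenControlDefect
import Summits.BirchSwinnertonDyer.Rank1Residual.Additive.QuadraticBranchOddStrictExactControlDischarge
import HarnessLib

/-!
# The LOWER HALF of the even exact control (T-e2-r0), DISCHARGED modulo three readings:
# `(R1⁺) → (R2⁺) → (L0⁺) → ord_p #Sel_{p^∞}(W/ℚ) ≤ v_p(L_p⁺(V, η, 0)) ≤ ord_p #Sel_{p^∞}(W/ℚ) +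
# ord_p(Tam(W)/#W(ℚ)_tors²)`, with the NEW typed local reading (L0⁺) = Kobayashi's (9.33) at `n = 0`
# (cell `bsd-potss`, seat `bsd-potss-ctrl` g2; file 5 of the T-e2-r0 series — files 1, 2, 4 = p401824,
# p401865, p402104)

HONEST FRAMING (cell `bsd-potss`, run/shared/lean/pub/bsd-potss/; FULL-BSD rank ≤ 1 programme,
tranche 1b): ONE `@[conjecture] def` (a READING of a printed theorem, typed as an input, NOTHING
asserted) and THEOREMS (compositions of the seat's files 1, 4 with x1b's bookkeeping); no named Literature
fact, no `sorry`, axioms standard. CONDITIONAL on the three displayed readings (R1⁺) `EvenBranchPlusCharIdealOfPlusMCAt`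
((C1_η) read on the `W`-coordinate plus dual data), (R2⁺) `EvenBranchPlusNoFiniteSubmoduleAt`
(Kitajima–Otsuki sign `+`), (L0⁺) `EvenBranchPlusLocalControlZeroAt` (Kobayashi (9.33)); (C1_η) is a
hypothesis INSIDE the discharged statements; nothing is booked; no label / mark / count moves; Gss2 /
O5a / O10-PS stay OPEN; nothing about `BSD(W, p)` of any pair is claimed here (the value side and the
`BSD` consumer are the sequel).

## What

* §1 (L0⁺) `EvenBranchPlusLocalControlZeroAt W p` — READING of Kobayashi 2003 (9.33)/Prop. 9.2 at
  `n = 0` on the `η`-component, in `W`-coordinates: for the `p*`-twist `W` of a good `a_p = 0` curve and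
  the cyclotomic `ℤ_p`-extension, every class over `ℚ` whose restriction to `ℚ_∞` satisfies the
  LEVEL-`∞` conditions (classical everywhere, PLUS-Kummer at `ℚ_[p]`) satisfies the LEVEL-`0` plus
  Kummer condition at `ℚ_[p]` — which at `n = 0` is the classical Kummer condition (`E⁺(F_{0,p}) = E(ℚ_p)`):
  "For `v | p`, the kernel of `r_v` is zero by (9.33)" (proof of Thm. 9.3, p. 27). Its kernel proof
  (B3's decomposition `H¹(ℚ_p, W[p^m]) = 𝓚 ⊕ Σ⁻` + the disjointness of the plus and minus Kummer
  conditions over the tower, Prop. 8.12 ii)) is this seat's next target; typed here so that the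
  assembly below is a theorem NOW.
* §2 **`padicValNat_card_selmerGroupPInfty_le_and_le_of_readings`** — for `W` globally minimal,
  `p ≥ 5`, the good `a_p = 0` twin `V` with (C1_η), newform `f`, period ratio `ϖ`, ANY `L` with
  `IsQuadraticBranchPlusLFunction f p ϖ L` and `L(0) ≠ 0`: **`Sel_{p^∞}(W/ℚ)` is finite and
  `ord_p #Sel ≤ v_p(L(0)) ≤ ord_p #Sel + ord_p(Tam(W)/#W(ℚ)_tors²)`** — file 1's identity
  `ord_p #Sel + ord_p #(A₀⁺⧸Sel⁺_0) = v_p(L(0))` on the plus dual datum ((R1⁺): `char = (L)`; (R2⁺): no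
  finite submodule), file 4's bound `ord_p #(A₀⁺⧸Sel⁺_0) ≤ ∑_{ℓ ≠ p} ord_p c_ℓ(W)` under (L0⁺), and x1b's
  bookkeeping `∑_{ℓ≠p} ord_p c_ℓ = ord_p Tam(W)` (`p ∤ c_p(W) ≤ 4`), `p ∤ #W(ℚ)_tors` (`W(ℚ_p)[p] = 0`).
  The RIGHT inequality is the LOWER HALF `ord_p #Ш(W)_an ≤ ord_p #Ш(W)[p^∞]` of `BSD(W, p)` in analytic
  rank `0` once the VALUE side `v_p(L(0)) = v_p(L(W,1)/Ω_W)` is supplied (sequel); the upper half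
  `v_p(L(0)) = ord_p #Sel + ord_p Tam` needs the rank-zero Cassels–Poitou–Tate count (sequel) — or Kato.

References: [Kobayashi2003] S. Kobayashi, Invent. Math. 152 (2003), Def. 1.1 (p. 2), Def. 2.1 (p. 5),
§4 (p. 8), Prop. 8.12 (p. 17), Lemma 9.1, Prop. 9.2, Thm. 9.3 with (9.33) (pp. 25–27); [GreenbergLNM1716]
§3 Lemma 3.3, §4 Thm. 4.1, Lemma 4.2 (p. 102); [KitajimaOtsuki2018] Main Thm. 1.3 (arXiv:1607.03612
p. 3); B. D. Kim, J. Aust. Math. Soc. 95 (2013), Thm. 1.1 (shape).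
-/

noncomputable section

open scoped Classical MatrixGroups ModularForm

open CongruenceSubgroup Field Function NumberField IsDedekindDomain WeierstrassCurve
open Literature.NumberTheory.EllipticCurves
open Literature.NumberTheory.EllipticCurves.ModularForms
open Literature.NumberTheory.EllipticCurves.Kobayashi2003
open Literature.NumberTheory.EllipticCurves.Rank1Residual
open Literature.NumberTheory.GaloisRepresentations
open Literature.NumberTheory.EllipticCurves.IwasawaAlgebra
open Literature.NumberTheory.EllipticCurves.IwasawaDual ZpExtension

namespace Summit.BirchSwinnertonDyer.Rank1Residual.Additive

/-! ## §1 (L0⁺) — Kobayashi's (9.33) at `n = 0` on the `η`-component, READ in `W`-coordinates -/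

/-- **TYPED INPUT (L0⁺) — READING of Kobayashi 2003, Prop. 9.2 / (9.33) at the bottom layer `n = 0`
on the component `η = ω^{(p−1)/2}`, in `W`-coordinates; flag `Kob03-933-plus-eta-twist-reading`;
NOTHING asserted.** For `W/ℚ` globally minimal, `p` odd, `V` a globally minimal model of `W^{(p*)}`
(`C • W.quadraticTwist ((−1)^{p/2} p) = V`) with good reduction at `p` and `a_p(V) = 0`, and the
cyclotomic `ℤ_p`-extension `κ` of `ℚ`: every class `y ∈ H¹(ℚ, W[p^∞])` whose restriction to `ℚ_∞` lies
in `Sel_{p^∞}(W/ℚ_∞)` and in the LEVEL-`∞` PLUS Kummer condition at every conjugate of the embedding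
at `p` (x1b's B2 group `Sel^{loc,∞,+}(W/ℚ)`) satisfies the LEVEL-`0` plus Kummer condition at `ℚ_[p]`
— i.e. (Def. 1.1 at `n = 0`: `E⁺(F_{0,p}) = E(ℚ_p)`) is Kummer of a point of `W(ℚ_p)`. This is the
`η`-part of "(9.33) `H⁺(k_0) → lim→ H⁺(k_m)` is injective", `H⁺(k_n) = H¹(k_n, V[p^∞])^{ω_n⁺=0}/
(E⁺(k_n) ⊗ ℚ_p/ℤ_p)`, `ω_0⁺ = X` (the dual of Prop. 9.2 (9.30), proved in print from Thm. 6.2), used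
in the proof of Thm. 9.3 as "For `v | p`, the kernel of `r_v` is zero by (9.33)". Kernel route
(this seat's sequel): x1b's B3 `H¹(ℚ_p, W[p^m]) = 𝓚_m ⊕ Σ⁻_m` (`SignedTwist.closure_minus_sup_eq_top_and_card_eq_padic_cyclotomic`)
and the disjointness of the plus and strict-minus Kummer conditions over the tower (Prop. 8.12 ii):
`E = E⁺ + E⁻`, `E⁺ ∩ E⁻ = E(K_{−1})`, tree `KobayashiSignedGenerationTower` /
`CyclotomicTowerSignedLocalIntersection`). [cite: Kobayashi2003, Prop. 9.2 and (9.33) (pp. 25–26), proof of Thm. 9.3 (p. 27), Def. 1.1 (p. 2), Prop. 8.12 (p. 17)]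
[cite: GreenbergLNM1716, §3 pp. 85–90 (the local kernels `ker r_v`)] -/
@[conjecture] def EvenBranchPlusLocalControlZeroAt (W : WeierstrassCurve ℚ) [W.IsElliptic]
    [W.IsGloballyMinimal] (p : ℕ) [Fact p.Prime] : Prop :=
  ∀ (V : WeierstrassCurve ℚ) [V.IsElliptic] [V.IsGloballyMinimal] (C : VariableChange ℚ),
    p ≠ 2 → C • W.quadraticTwist ((-1) ^ (p / 2) * p) = V →
    V.HasGoodReductionAtPrime p → V.frobeniusTrace p = 0 →
    ∀ (κ : ZpExtension ℚ p), κ.IsCyclotomic →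
    ∀ y ∈ (W.selmerInfty κ ⊓
          ⨅ σ : Field.absoluteGaloisGroup ℚ,
            (localKummerOverOfEmb W p κ.kerSubgroup (closureEmb (K := ℚ) ℚ_[p])
                (⨆ m, strictSignedLocalPoints κ ℚ_[p] W 1 m)).comap (W.conjH1 p κ.kerSubgroup σ)).comap
          (W.layerToInfty κ 0),
      y ∈ localKummerOverOfEmb W p (κ.layerSubgroup 0) (closureEmb (K := ℚ) ℚ_[p])
        (strictSignedLocalPoints κ ℚ_[p] W 1 0)

/-! ## §2 The two inequalities of the even exact control, modulo (R1⁺), (R2⁺), (L0⁺) -/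

namespace EvenControlZero

variable (W : WeierstrassCurve ℚ) [W.IsElliptic] [W.IsGloballyMinimal] (p : ℕ) [hp : Fact p.Prime]

/-- **T-e2-r0, BOTH INEQUALITIES, modulo the three readings.** For `W` globally minimal, `p ≥ 5`, the
good `a_p = 0` twin `V` (`C • W.quadraticTwist ((−1)^{p/2} p) = V`) with (C1_η), its newform `f`, the
period ratio `ϖ` and ANY `L` with `IsQuadraticBranchPlusLFunction f p ϖ L`, `L(0) ≠ 0`:
**`Sel_{p^∞}(W/ℚ)` is finite, `ord_p #Sel_{p^∞}(W/ℚ) ≤ v_p(L(0))`, and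
`v_p(L(0)) ≤ ord_p #Sel_{p^∞}(W/ℚ) + ord_p(Tam(W)/#W(ℚ)_tors²)`.** Proof: the cyclotomic `ℤ_p`-extension
with a normalised topological generator and a plus dual datum `D` exist (tree `CyclotomicZp`,
`nonempty_strictSignedSelmerDualData`); (R1⁺) ⟹ `X⁺` f.g. torsion, `char = (L)`; (R2⁺) ⟹ no finite
submodule; file 1 ⟹ `ord_p #Sel + ord_p #(A₀⁺⧸Sel⁺_0) = v_p(L(0))` with `A₀⁺` finite; (L0⁺) + file 4 ⟹
`ord_p #(A₀⁺⧸Sel⁺_0) ≤ ∑_{v ∈ S, v ∤ p} ord_p c_v(W)` over the bad places; x1b's bookkeeping ⟹ `= ord_p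
Tam(W)` (`ord_p c_p(W) = 0` for the twist of a good curve, `p ≥ 5`) and `ord_p #W(ℚ)_tors = 0`
(`W(ℚ_p)[p] = 0`). CONDITIONAL on the three readings and (C1_η); nothing booked.
[cite: Kobayashi2003, §4 (p. 8), Thm. 9.3 with (9.33) (pp. 26–27), Lemma 9.1 (p. 25)]
[cite: KitajimaOtsuki2018, Main Thm. 1.3 (arXiv:1607.03612 p. 3)]
[cite: GreenbergLNM1716, §3 Lemma 3.3, §4 Thm. 4.1 and Lemma 4.2 (p. 102)]
[cite: SilvermanAEC2009, Thm. VII.6.1 (Kodaira–Néron) and Prop. VII.3.1] -/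
theorem finite_and_padicValNat_card_selmerGroupPInfty_le_and_le_of_readings
    (hR1 : EvenBranchPlusCharIdealOfPlusMCAt W p) (hR2 : EvenBranchPlusNoFiniteSubmoduleAt W p)
    (hL0 : EvenBranchPlusLocalControlZeroAt W p)
    (V : WeierstrassCurve ℚ) [V.IsElliptic] [V.IsGloballyMinimal] (C : VariableChange ℚ)
    {N : ℕ} [NeZero N] {f : CuspForm (Gamma0 N) 2}
    (hp5 : 5 ≤ p) (hCV : C • W.quadraticTwist ((-1) ^ (p / 2) * p) = V)
    (hgood : V.HasGoodReductionAtPrime p) (hap : V.frobeniusTrace p = 0)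
    (h1 : QuadraticBranchPlusMainConjectureAt V p) (hf : IsNewformOf V f) {ϖ : ℚ}
    (hϖ : if Even (p / 2) then (ϖ : ℝ) * V.realPeriodRat = plusPeriod f
      else (ϖ : ℝ) * V.imaginaryPeriodRat = minusPeriod f)
    {L : IwasawaAlgebra p} (hL : IsQuadraticBranchPlusLFunction f p ϖ L)
    (h0 : PowerSeries.constantCoeff L ≠ 0) :
    Finite ↥(W.selmerGroupPInfty p) ∧
      (padicValNat p (Nat.card ↥(W.selmerGroupPInfty p)) : ℤ) ≤
        ((PowerSeries.constantCoeff L : ℤ_[p]) : ℚ_[p]).valuation ∧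
      ((PowerSeries.constantCoeff L : ℤ_[p]) : ℚ_[p]).valuation ≤
        (padicValNat p (Nat.card ↥(W.selmerGroupPInfty p)) : ℤ) +
          padicValRat p ((W.tamagawaProduct : ℚ) / (W.torsionOrder : ℚ) ^ 2) := by
  have hp2 : p ≠ 2 := by omega
  set v₀ := (Rat.HeightOneSpectrum.primesEquiv (R := 𝓞 ℚ)).symm ⟨p, hp.out⟩ with hv₀
  -- the cyclotomic `ℤ_p`-extension of `ℚ`, a normalised topological generator, a plus dual datum
  obtain ⟨γ, hγ, hχ⟩ := CyclotomicZp.exists_isTopGenerator_zpExtension p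
  have hκ := CyclotomicZp.isCyclotomic_zpExtension p
  have hγc : IsCyclotomicVariable p γ := ⟨1, IsOfFinOrder.one, by rw [mul_one]; exact hχ⟩
  obtain ⟨D⟩ := nonempty_strictSignedSelmerDualData W (CyclotomicZp.zpExtension p) ℚ_[p] 1 hγ
  -- (R1⁺), (R2⁺)
  obtain ⟨hfg, htor, hchar⟩ := hR1 V C hp2 hCV hgood hap h1 hf ϖ hϖ L hL _ γ hκ hγ hγc D
  haveI := hfg
  have hnf := hR2 V C hp2 hCV hgood hap _ γ hκ hγ D hfg htor
  -- file 1: the identity and the finiteness of `A₀⁺`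
  obtain ⟨hfinSel, -, heq, hA⟩ :=
    finite_and_padicValNat_card_selmerGroupPInfty_add_eq_of_quadraticTwist_signedPrime W
      (CyclotomicZp.zpExtension p) hp2 C V hCV hgood hap hγ D htor hnf hchar h0
  haveI hfinA : Finite (↥((W.selmerInfty (CyclotomicZp.zpExtension p) ⊓
      ⨅ σ : Field.absoluteGaloisGroup ℚ,
        (localKummerOverOfEmb W p (CyclotomicZp.zpExtension p).kerSubgroup (closureEmb (K := ℚ) ℚ_[p])
            (⨆ m, strictSignedLocalPoints (CyclotomicZp.zpExtension p) ℚ_[p] W 1 m)).comap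
          (W.conjH1 p (CyclotomicZp.zpExtension p).kerSubgroup σ)).comap
      (W.layerToInfty (CyclotomicZp.zpExtension p) 0))) :=
    Nat.finite_of_card_ne_zero (by rw [hA]; exact pow_ne_zero _ hp.out.ne_zero)
  refine ⟨hfinSel, by rw [← heq]; exact le_add_of_nonneg_right (Int.natCast_nonneg _), ?_⟩
  -- file 4 under (L0⁺): the defect is bounded by the Tamagawa exponents away from `p`
  obtain ⟨S, hS⟩ := exists_finset_forall_not_mem_good W p
  have hloc := hL0 V C hp2 hCV hgood hap (CyclotomicZp.zpExtension p) hκ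
  have hdef := StrictSignedControlZero.padicValNat_card_quotient_le_sum_of_loc W
    (CyclotomicZp.zpExtension p) 1 hκ S hS hloc
  -- bookkeeping: `∑_{v ∈ S, v ∤ p} ord_p c_v = ord_p Tam(W)`, `ord_p #W(ℚ)_tors = 0`
  set T := S.filter (fun v ↦ (p : 𝓞 ℚ) ∉ v.asIdeal) with hT
  have hv₀p : (p : 𝓞 ℚ) ∈ v₀.asIdeal := (natCast_mem_asIdeal_iff_eq_primesEquiv_symm v₀ hp.out).mpr rfl
  have hpT : v₀ ∉ T := fun h ↦ (Finset.mem_filter.mp h).2 hv₀p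
  have hTmem : ∀ v : HeightOneSpectrum (𝓞 ℚ), v ≠ v₀ →
      p ∣ (W.baseChange (v.adicCompletion ℚ)).localTamagawaNumber (v.adicCompletionIntegers ℚ) → v ∈ T := by
    intro v hv hdvd
    refine Finset.mem_filter.mpr ⟨?_, fun hpv ↦ hv ((natCast_mem_asIdeal_iff_eq_primesEquiv_symm v hp.out).mp hpv)⟩
    by_contra hvS
    rw [W.localTamagawaNumber_eq_one_of_hasGoodReductionAt_holds v (hS v hvS).2] at hdvd
    exact hp.out.one_lt.ne' (Nat.dvd_one.mp hdvd)
  have hc0 := LevelBridge.padicValNat_localTamagawaNumber_eq_zero_of_quadraticTwist_signedPrime W p hp5 C V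
    hCV hgood
  have hTamSum := LevelBridge.sum_padicValNat_localTamagawaNumber_eq_padicValNat_tamagawaProduct W p T hpT
    hTmem hc0
  have htors := eq_zero_of_prime_smul_eq_zero_padic_of_quadraticTwist_goodSupersingular hp2 W C V hCV hgood hap
  have htors0 := LevelBridge.padicValNat_torsionOrder_eq_zero_of_noPTorsion W p htors
  have hTamQ : (W.tamagawaProduct : ℚ) ≠ 0 := by exact_mod_cast W.tamagawaProduct_pos_holds.ne'
  have htQ : (W.torsionOrder : ℚ) ≠ 0 := by exact_mod_cast W.torsionOrder_pos_holds.ne'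
  have hrat : padicValRat p ((W.tamagawaProduct : ℚ) / (W.torsionOrder : ℚ) ^ 2) =
      (padicValNat p W.tamagawaProduct : ℤ) := by
    rw [padicValRat.div hTamQ (pow_ne_zero 2 htQ), padicValRat.pow, padicValRat.of_nat, padicValRat.of_nat,
      htors0]
    simp
  rw [hrat, ← heq, ← hTamSum]
  push_cast
  linarith [show (padicValNat p (Nat.card (↥((W.selmerInfty (CyclotomicZp.zpExtension p) ⊓
      ⨅ σ : Field.absoluteGaloisGroup ℚ,
        (localKummerOverOfEmb W p (CyclotomicZp.zpExtension p).kerSubgroup (closureEmb (K := ℚ) ℚ_[p])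
            (⨆ m, strictSignedLocalPoints (CyclotomicZp.zpExtension p) ℚ_[p] W 1 m)).comap
          (W.conjH1 p (CyclotomicZp.zpExtension p).kerSubgroup σ)).comap
      (W.layerToInfty (CyclotomicZp.zpExtension p) 0)) ⧸
        (strictSignedSelmerLayer W (CyclotomicZp.zpExtension p) ℚ_[p] 1 0).addSubgroupOf
          ((W.selmerInfty (CyclotomicZp.zpExtension p) ⊓
      ⨅ σ : Field.absoluteGaloisGroup ℚ,
        (localKummerOverOfEmb W p (CyclotomicZp.zpExtension p).kerSubgroup (closureEmb (K := ℚ) ℚ_[p])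
            (⨆ m, strictSignedLocalPoints (CyclotomicZp.zpExtension p) ℚ_[p] W 1 m)).comap
          (W.conjH1 p (CyclotomicZp.zpExtension p).kerSubgroup σ)).comap
      (W.layerToInfty (CyclotomicZp.zpExtension p) 0)))) : ℤ) ≤
      ((∑ v ∈ T, padicValNat p ((W.baseChange (v.adicCompletion ℚ)).localTamagawaNumber
        (v.adicCompletionIntegers ℚ)) : ℕ) : ℤ) by exact_mod_cast hdef]

end EvenControlZero

end Summit.BirchSwinnertonDyer.Rank1Residual.Additive

end
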